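import Summits.NavierStokesRegularity.NavierStokesRegularity.Theorems.SoloSalvageWu2026Step341
import Summits.NavierStokesRegularity.NavierStokesRegularity.Theorems.SoloSalvageWu2026StepP33
import Literature.Analysis.FluidPDE.SteadyVorticityDecayLiouvilleBridge
import HarnessLib

/-!
# C177 `Wu2026` — COMPOSITION RECORD, third reduction: one open binder left (`Step_construct`)

D-0090 NS-CLAIMS sweep, claim C177 (W. Wu, arXiv:2608.22471v1), skeleton
`Literature/Claims/NS/Wu2026.lean`; D-0154 (2) INPUTS (director-ns req136, seats `ns-in-wu-341`,
`ns-in-wu-p33`, `ns-in-wu-con`). With `step_341` (§3.3, (3.36)+(3.41)) and `step_P33` (Prop 3.3)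
now kernel theorems next to `step_L21`, `step_33`, `step_38`, `step_L31`, `step_318`, `step_382`,
`step_385`, `step_386`, `step_387`, `step_P34`, `step_D0`, the composition of record
`wu2026_thm11_of_four_open_steps` reduces to ONE open binder, `Step_construct` (§3.2–§3.4, the
existence of the Euler blow-down tangent). This file records the reduced chain up to the tree's
vorticity-rate Liouville fact (route-independent: no `Theses` import), so that the seat landing
`step_construct : Step_construct` closes item stmt-NavierStokesRegularity-0897 with the one-line
term `GaldiLiouvilleGate.criticalRateLiouville_of_wu2026
(wu2026_critical_vorticity_liouville_of_step_construct step_construct)` (in a file importing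
`Theorems/GaldiLiouvilleGateCriticalRateLiouvilleOfWu2026`):

* `claimedTheorem_of_step_construct`, `wu2026_thm11_of_step_construct`,
  `wu2026_cor12_of_step_construct`, `wu2026_critical_vorticity_liouville_of_step_construct` —
  Theorem 1.1 / Corollary 1.2 / the tree's fact `Wu2026_critical_vorticity_liouville`, each
  CONDITIONAL on `Step_construct` only (via the tree's PROVED bridges `Wu2026_cor12_of_thm11`,
  `Wu2026_critical_vorticity_liouville_of_cor12`).

Every theorem here is CONDITIONAL on the named binder `Step_construct` (a `def : Prop` of the
skeleton, taken as a hypothesis); nothing is asserted about it. WHAT THIS IS NOT: not a claim about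
NS regularity or blow-up; no summit statement is proved here; records, not a verdict on the
preprint.
-/

noncomputable section

set_option linter.dupNamespace false

namespace Summit.NavierStokesRegularity.NavierStokesRegularity.Theorems.Wu2026Salvage

open Literature.Claims.NS.Wu2026

/-- **Theorem 1.1 of arXiv:2608.22471v1 from the single binder not yet ported** (`Step_construct`,
§3.2–§3.4 tangent construction); all other steps are kernel theorems (`step_341`, `step_P33`,
`step_385`, and those inside `claimedTheorem_of_four_open_steps`). [cite: Wu2026, Thm 1.1 p.2 l.30–37; proof §3 p.7–26] -/
theorem claimedTheorem_of_step_construct (hcon : Step_construct) : ClaimedTheorem :=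
  claimedTheorem_of_four_open_steps step_341 hcon step_P33 step_385

/-- The same for the tree's named fact `Wu2026_thm11`, conditional on `Step_construct`. [cite: Wu2026, Thm 1.1 p.2 l.30–37] -/
theorem wu2026_thm11_of_step_construct (hcon : Step_construct) :
    Literature.Analysis.FluidPDE.Wu2026_thm11 :=
  claimedTheorem_of_step_construct hcon

/-- Corollary 1.2, conditional on `Step_construct` (via the tree's PROVED `Wu2026_cor12_of_thm11`).
[cite: Wu2026, Cor 1.2 p.2 l.42–56] -/
theorem wu2026_cor12_of_step_construct (hcon : Step_construct) :
    Literature.Analysis.FluidPDE.Wu2026_cor12 :=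
  claimedCor_of_claimedTheorem (claimedTheorem_of_step_construct hcon)

/-- The tree's vorticity-rate Liouville fact `Wu2026_critical_vorticity_liouville`, conditional on
`Step_construct` (bridge `Wu2026_critical_vorticity_liouville_of_cor12`). [cite: Wu2026, Cor 1.2 p.2 l.42–56] -/
theorem wu2026_critical_vorticity_liouville_of_step_construct (hcon : Step_construct) :
    Literature.Analysis.FluidPDE.Wu2026_critical_vorticity_liouville :=
  Literature.Analysis.FluidPDE.Wu2026_critical_vorticity_liouville_of_cor12
    (wu2026_cor12_of_step_construct hcon)

end Summit.NavierStokesRegularity.NavierStokesRegularity.Theorems.Wu2026Salvage
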